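import Mathlib
import Summits.CriticalPhenomena.CardyFormulaZ2.Theorems.CardyMagicRigidityDefs
import Summits.CriticalPhenomena.CardyFormulaZ2.Theorems.CardyMagicRigidityPositiveConeDefs
import Summits.CriticalPhenomena.CardyFormulaZ2.Theorems.CardyMagicRigidityNestingRigidityPrecompactnessReduction
import Literature.Probability.Percolation.FullPlaneCNL
import Literature.Probability.Percolation.LoopRepresentationProofs
import Literature.Probability.RandomPlanarGeometry.LoopConfigurationsMetric
import HarnessLib

/-!
# Stub `stub_precompactness`: the Cauchy property and interchangeability of `d_CN`-limit presentations

Crux `Summit.CriticalPhenomena.CardyFormulaZ2.Theses.CardyMagicRigidity.NestingRigidity`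
(stmt-CriticalPhenomena-4835), line `positive-cone-weight-doubling`, registered stub `stub_precompactness :
PrecompactRegular zEns ∧ PrecompactRegular tEns`.  The reduction file `…PrecompactnessReduction` (p128809) splits
the statement into pure `d_CN`-precompactness (T1) and regular modification of limit presentations (T2'), the
latter quantified over ALL presentations `X : [0,1] → C` of a sequential `d_CN`-limit — including presentations
with non-measurable exceptional events, for which no gluing of couplings is available.  This file shows that this
generality costs nothing for the LATTICE ensembles, and records the measurable variant of the glue:

* `measurableSet_isClose_latticeEnsembles` — the exceptional events between two meshes of one lattice ensemble are
  measurable (`measurableSet_isClose_bondLoopConfig`, `measurableSet_isClose_siteLoopConfig`);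
* `Precompact.cnLawEDist_cauchy_of_tendsto` — **a `d_CN`-convergent sequence of lattice laws is `d_CN`-Cauchy**,
  whatever the limit presentation `X` (gluing `LoopConfig.cnLawEDist_triangle` through the middle law `X` needs
  measurability only for the OUTER, lattice–lattice, pair);
* `tendsto_cnLawEDist_of_subseq_limit` (registered anchor) — **interchangeability**: if the lattice laws along
  `δₖ` converge in `d_CN` to SOME presentation `X` and, along a subsequence, to a presentation `X̂` on a standard
  Borel probability space with measurable exceptional events, then they converge to `X̂` along the FULL sequence
  (Cauchy + triangle through the lattice law at a far subsequence index).  Hence the regular-modification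
  statement T2' of the reduction need only be proved for ONE convenient presentation of each limit law;
* `precompactRegular_of_measurable_limits` — the glue with both T1 and T2 restricted to presentations with
  measurable exceptional events (the form an Aizenman–Burchard construction of the limit delivers and the form
  the a.s.-regularity bricks `…PrecompactnessLimitSamples` consume).
-/

noncomputable section

open MeasureTheory Set Filter Metric
open scoped Real Topology BigOperators ENNReal unitInterval

namespace Summit.CriticalPhenomena.CardyFormulaZ2.Cruxes.NestingRigidity.PositiveConeWeightDoubling

open Literature.Probability.RandomPlanarGeometry Literature.Probability.Percolation
  Literature.Probability.LatticeModels
open Summit.CriticalPhenomena.CardyFormulaZ2.Theses.CardyMagicRigidity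
open Summit.CriticalPhenomena.CardyFormulaZ2.Cruxes.NestingRigidity.RingCloudTomography

/-! ### Lattice-side measurability and instances -/

/-- The exceptional events `{(ω, ω') | d_CN(E.X δ ω, E.X δ' ω') ≤ ε}` between two meshes of one lattice ensemble
are measurable (both representations are countably generated with measurable generating events). -/
theorem measurableSet_isClose_latticeEnsembles : ∀ E ∈ latticeEnsembles, ∀ (δ δ' ε : ℝ),
    MeasurableSet {p : E.Ω × E.Ω | LoopConfig.IsClose ε (E.X δ p.1) (E.X δ' p.2)} := by
  intro E hE δ δ' ε
  simp only [latticeEnsembles, Set.mem_insert_iff, Set.mem_singleton_iff] at hE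
  rcases hE with rfl | rfl
  · exact measurableSet_isClose_bondLoopConfig δ 0 δ' 0 ε
  · exact measurableSet_isClose_siteLoopConfig δ δ' ε

namespace Precompact

/-- Instances of a lattice ensemble used for gluing: standard Borel non-empty sample space, probability law. -/
theorem instances_of_mem {E : LoopEnsemble} (hE : E ∈ latticeEnsembles) :
    StandardBorelSpace E.Ω ∧ Nonempty E.Ω ∧ IsProbabilityMeasure E.P := by
  simp only [latticeEnsembles, Set.mem_insert_iff, Set.mem_singleton_iff] at hE
  rcases hE with rfl | rfl
  · exact ⟨standardBorelSpace_bondConfig, ⟨(∅ : Set (Sym2 (Site 2)))⟩,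
      inferInstanceAs (IsProbabilityMeasure (bondPercolation (zdGraph 2) half))⟩
  · exact ⟨standardBorelSpace_siteConfig, ⟨(∅ : Set (Site 2))⟩,
      inferInstanceAs (IsProbabilityMeasure (triSitePercolation half))⟩

/-! ### The Cauchy property -/

/-- **A `d_CN`-convergent sequence of lattice laws is `d_CN`-Cauchy**, whatever the limit presentation:
`d_CN(E_k, E_l) ≤ d_CN(E_k, X) + d_CN(X, E_l)` (gluing through the middle law `X` — no hypothesis on `X` — with
the lattice–lattice exceptional event measurable), so for every `η > 0` eventually in `(k, l)` the distance is
`< η`. -/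
theorem cnLawEDist_cauchy_of_tendsto {E : LoopEnsemble} (hE : E ∈ latticeEnsembles) {Ω' : Type*}
    [MeasurableSpace Ω'] {ν : Measure Ω'} [IsProbabilityMeasure ν] {X : Ω' → LoopConfig ℂ} {δs : ℕ → ℝ}
    (h : Tendsto (fun k : ℕ ↦ LoopConfig.cnLawEDist E.P (E.X (δs k)) ν X) atTop (𝓝 0)) {η : ℝ≥0∞}
    (hη : 0 < η) :
    ∀ᶠ p : ℕ × ℕ in atTop ×ˢ atTop,
      LoopConfig.cnLawEDist E.P (E.X (δs p.1)) E.P (E.X (δs p.2)) < η := by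
  obtain ⟨hSB, hne, hprob⟩ := instances_of_mem hE
  haveI := hSB; haveI := hne; haveI := hprob
  have hη2 : (0 : ℝ≥0∞) < η / 2 := ENNReal.half_pos hη.ne'
  have h₁ : ∀ᶠ k in atTop, LoopConfig.cnLawEDist E.P (E.X (δs k)) ν X < η / 2 := h (Iio_mem_nhds hη2)
  filter_upwards [h₁.prod_mk h₁] with p hp
  calc LoopConfig.cnLawEDist E.P (E.X (δs p.1)) E.P (E.X (δs p.2))
      ≤ LoopConfig.cnLawEDist E.P (E.X (δs p.1)) ν X + LoopConfig.cnLawEDist ν X E.P (E.X (δs p.2)) :=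
        LoopConfig.cnLawEDist_triangle E.P ν E.P (E.X (δs p.1)) X (E.X (δs p.2))
          (measurableSet_isClose_latticeEnsembles E hE (δs p.1) (δs p.2))
    _ < η / 2 + η / 2 := by
        rw [LoopConfig.cnLawEDist_comm ν X]
        exact ENNReal.add_lt_add hp.1 hp.2
    _ = η := ENNReal.add_halves η

end Precompact

/-! ### Interchangeability of limit presentations along the full sequence -/

open Precompact in
/-- **Interchangeability of `d_CN`-limit presentations (registered anchor).**  Let `E ∈ latticeEnsembles` and
`δₖ` a mesh sequence along which the laws of `E.X δₖ` converge in DKKMO's coupling distance to SOME presentation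
`X` (on any probability space, no measurability asked).  If along a subsequence `φ` they also converge to a
presentation `X̂` on a standard Borel probability space whose exceptional events against the lattice samples are
measurable, then they converge to `X̂` along the FULL sequence:
`d_CN(E_k, X̂) ≤ d_CN(E_k, E_{φ j}) + d_CN(E_{φ j}, X̂)`, the first term small by the Cauchy property
(`Precompact.cnLawEDist_cauchy_of_tendsto`), the second by hypothesis, for a far index `j`. -/
theorem tendsto_cnLawEDist_of_subseq_limit : ∀ E ∈ latticeEnsembles, ∀ (δs : ℕ → ℝ) (φ : ℕ → ℕ)
    {Ω' : Type} [MeasurableSpace Ω'] (ν : Measure Ω') [IsProbabilityMeasure ν] (X : Ω' → LoopConfig ℂ)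
    {Ω'' : Type} [MeasurableSpace Ω''] [StandardBorelSpace Ω''] [Nonempty Ω''] (ν' : Measure Ω'')
    [IsProbabilityMeasure ν'] (X' : Ω'' → LoopConfig ℂ),
    Tendsto φ atTop atTop →
    (∀ (k : ℕ) (ε : ℝ), MeasurableSet {p : E.Ω × Ω'' | LoopConfig.IsClose ε (E.X (δs k) p.1) (X' p.2)}) →
    Tendsto (fun k : ℕ ↦ LoopConfig.cnLawEDist E.P (E.X (δs k)) ν X) atTop (𝓝 0) →
    Tendsto (fun j : ℕ ↦ LoopConfig.cnLawEDist E.P (E.X (δs (φ j))) ν' X') atTop (𝓝 0) →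
    Tendsto (fun k : ℕ ↦ LoopConfig.cnLawEDist E.P (E.X (δs k)) ν' X') atTop (𝓝 0) := by
  intro E hE δs φ Ω' _ ν _ X Ω'' _ _ _ ν' _ X' hφ hm h h'
  obtain ⟨hSB, hne, hprob⟩ := instances_of_mem hE
  haveI := hSB; haveI := hne; haveI := hprob
  rw [ENNReal.tendsto_nhds_zero]
  intro η hη
  have hη2 : (0 : ℝ≥0∞) < η / 2 := ENNReal.half_pos hη.ne'
  -- Cauchy in `(k, l)`, and convergence to `X'` along `φ`
  have hc := cnLawEDist_cauchy_of_tendsto hE h hη2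
  have h₂ : ∀ᶠ j in atTop, LoopConfig.cnLawEDist E.P (E.X (δs (φ j))) ν' X' < η / 2 := h' (Iio_mem_nhds hη2)
  -- pairs `(k, φ j)` with `k, j → ∞` are eventually Cauchy-close
  have hc' : ∀ᶠ p : ℕ × ℕ in atTop ×ˢ atTop,
      LoopConfig.cnLawEDist E.P (E.X (δs p.1)) E.P (E.X (δs (φ p.2))) < η / 2 := by
    filter_upwards [(tendsto_id.prodMap hφ).eventually hc] with p hp
    simpa using hp
  obtain ⟨pa, hpa, pb, hpb, hsub⟩ := Filter.eventually_prod_iff.1 (hc'.and (h₂.prod_inr atTop))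
  obtain ⟨j, hj⟩ := hpb.exists
  filter_upwards [hpa] with k hk
  obtain ⟨hkj, hj'⟩ := hsub hk hj
  calc LoopConfig.cnLawEDist E.P (E.X (δs k)) ν' X'
      ≤ LoopConfig.cnLawEDist E.P (E.X (δs k)) E.P (E.X (δs (φ j))) +
          LoopConfig.cnLawEDist E.P (E.X (δs (φ j))) ν' X' :=
        LoopConfig.cnLawEDist_triangle E.P E.P ν' (E.X (δs k)) (E.X (δs (φ j))) X' (hm k)
    _ ≤ η / 2 + η / 2 := add_le_add hkj.le hj'.le
    _ = η := ENNReal.add_halves η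

/-! ### The glue with measurable exceptional events -/

/-- **GLUE, measurable form.**  `PrecompactRegular E` for a lattice ensemble from: (T1m) every mesh sequence has a
subsequence along which the laws converge in `d_CN` to a presentation on `[0,1]` WITH MEASURABLE EXCEPTIONAL EVENTS
against the lattice samples; (T2m) every such presentation reached along a mesh sequence has an a.e.-`Regular`
modification with the same limit property.  (Pure logic; the measurability rider is what the a.s.-regularity
bricks of `…PrecompactnessLimitSamples` consume and what lets limit presentations be interchanged,
`tendsto_cnLawEDist_of_subseq_limit`.) -/
theorem precompactRegular_of_measurable_limits (E : LoopEnsemble)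
    (h₁ : ∀ δs : ℕ → ℝ, Tendsto δs atTop (𝓝[>] (0 : ℝ)) →
      ∃ φ : ℕ → ℕ, StrictMono φ ∧ ∃ X : unitInterval → LoopConfig ℂ,
        (∀ (δ ε : ℝ), MeasurableSet {p : E.Ω × unitInterval | LoopConfig.IsClose ε (E.X δ p.1) (X p.2)}) ∧
        Tendsto (fun k : ℕ ↦ LoopConfig.cnLawEDist E.P (E.X (δs (φ k))) volume X) atTop (𝓝 0))
    (h₂ : ∀ (δs : ℕ → ℝ) (X : unitInterval → LoopConfig ℂ), Tendsto δs atTop (𝓝[>] (0 : ℝ)) →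
      (∀ (δ ε : ℝ), MeasurableSet {p : E.Ω × unitInterval | LoopConfig.IsClose ε (E.X δ p.1) (X p.2)}) →
      Tendsto (fun k : ℕ ↦ LoopConfig.cnLawEDist E.P (E.X (δs k)) volume X) atTop (𝓝 0) →
      ∃ X' : unitInterval → LoopConfig ℂ, (∀ᵐ s : unitInterval, Regular (X' s)) ∧
        Tendsto (fun k : ℕ ↦ LoopConfig.cnLawEDist E.P (E.X (δs k)) volume X') atTop (𝓝 0)) :
    PrecompactRegular E := by
  intro δs hδs
  obtain ⟨φ, hφ, X, hm, hX⟩ := h₁ δs hδs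
  obtain ⟨X', hreg, hX'⟩ := h₂ (δs ∘ φ) X (hδs.comp hφ.tendsto_atTop) hm hX
  exact ⟨φ, hφ, X', hreg, hX'⟩

/-- Measurable form with the POINTWISE regular modification (T2 of the stub map, restricted to presentations with
measurable exceptional events): `d_CN(X s, X' s) = 0` a.e. suffices (Lemma L of the reduction file). -/
theorem precompactRegular_of_measurable_modification (E : LoopEnsemble) [IsProbabilityMeasure E.P]
    (h₁ : ∀ δs : ℕ → ℝ, Tendsto δs atTop (𝓝[>] (0 : ℝ)) →
      ∃ φ : ℕ → ℕ, StrictMono φ ∧ ∃ X : unitInterval → LoopConfig ℂ,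
        (∀ (δ ε : ℝ), MeasurableSet {p : E.Ω × unitInterval | LoopConfig.IsClose ε (E.X δ p.1) (X p.2)}) ∧
        Tendsto (fun k : ℕ ↦ LoopConfig.cnLawEDist E.P (E.X (δs (φ k))) volume X) atTop (𝓝 0))
    (h₂ : ∀ (δs : ℕ → ℝ) (X : unitInterval → LoopConfig ℂ), Tendsto δs atTop (𝓝[>] (0 : ℝ)) →
      (∀ (δ ε : ℝ), MeasurableSet {p : E.Ω × unitInterval | LoopConfig.IsClose ε (E.X δ p.1) (X p.2)}) →
      Tendsto (fun k : ℕ ↦ LoopConfig.cnLawEDist E.P (E.X (δs k)) volume X) atTop (𝓝 0) →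
      ∃ X' : unitInterval → LoopConfig ℂ, (∀ᵐ s : unitInterval, Regular (X' s)) ∧
        ∀ᵐ s : unitInterval, LoopConfig.cnEDist (X s) (X' s) = 0) :
    PrecompactRegular E := by
  refine precompactRegular_of_measurable_limits E h₁ fun δs X hδs hm hX ↦ ?_
  obtain ⟨X', hreg, h0⟩ := h₂ δs X hδs hm hX
  exact ⟨X', hreg, Precompact.tendsto_cnLawEDist_of_ae_cnEDist_eq_zero E.P (fun k ↦ E.X (δs k)) volume h0 hX⟩

end Summit.CriticalPhenomena.CardyFormulaZ2.Cruxes.NestingRigidity.PositiveConeWeightDoubling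

end
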